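import Mathlib
import Literature.NumberTheory.Irrationality.Zlobin2005.SorokinIntegralCoefficients
import HarnessLib

/-!
# `Le_{s⃗}(z)` as a member of Zlobin's family `S(z)` — PROOF of `Zlobin2005.le_eq_integral` (Zlobin 2012, Theorem 1)

Proofs-only sibling of `Zlobin2005/SorokinIntegralCoefficients.lean` (pattern `Zudilin2003/RatesProofs.lean`,
`BrownZudilin2022/BarnesDoubleProofs.lean`): it DISCHARGES the named Literature fact
`Literature.NumberTheory.Irrationality.Zlobin2005.le_eq_integral` by the theorem `le_eq_integral_holds` at
the end of the file; NO new definition, NO new named fact, the statement file is untouched.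

What is proved, as printed [cite: Zlobin2012SpecialValues, §2 Theorem 1 (arXiv:0712.1656 p. 3), first
identity]: "**Theorem 1.** The following integral representations of generalized polylogarithms are valid:
`Le_{s₁,s₂,…,s_l}(z) = z ∫_{[0,1]^m} dx₁dx₂⋯dx_m / ∏_{j=1}^{l} (1 − z x₁x₂⋯x_{r_j})`, … where
`r_j = s₁ + s₂ + ⋯ + s_j` and `m = r_l = w(s⃗)`. This theorem is proved by expanding each fraction of the form
`1/(1−t)` into a geometric series and then integrating termwise over a cube." — in the tree's rendering
(`le_eq_integral`): for every nonempty index `s⃗` of positive integers and every real `0 < z < 1`,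
`Le s z = z * (leParams s).S z`.

The proof is the printed one, made explicit:
* on the cube every `u_j = z·x₁⋯x_{r_j}` lies in `[0, z] ⊂ [0, 1)`, so
  `∏ⱼ (1 − u_j)⁻¹ = Σ_{k ∈ ℕ^l} ∏ⱼ u_j^{k_j}` (a finite product of geometric series; all terms `≥ 0`);
* termwise integration (`MeasureTheory.integral_tsum_of_summable_integral_norm`; the series of the integrals
  is dominated by `Σ_k z^{|k|} = (1 − z)^{−l}`);
* `∏ⱼ u_j^{k_j} = z^{|k|} ∏ᵢ xᵢ^{eᵢ}` with `eᵢ = Σ_{j : r_j > i} k_j`, and `∫_{[0,1]^m} ∏ᵢ xᵢ^{eᵢ} dx = ∏ᵢ (eᵢ+1)⁻¹`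
  (`MeasureTheory.Measure.restrict_pi_pi`, `MeasureTheory.integral_fintype_prod_eq_prod`, `integral_pow`);
* the bijection `k ↦ n`, `n_j = 1 + Σ_{t ≥ j} k_t`, between `ℕ^l` and the chains `n₁ ≥ n₂ ≥ ⋯ ≥ n_l ≥ 1`
  (`leIndexSet l`), under which `eᵢ = n_j − 1` for the `s_j` variables `i` of the `j`-th block
  `r_{j−1} ≤ i < r_j`, so that `∏ᵢ (eᵢ+1)⁻¹ = ∏ⱼ n_j^{−s_j} = mzvTerm s n` and `z · z^{|k|} = z^{n₁}`.

All auxiliary statements are private and written out in the tree's vocabulary (`leIndexSet`, `leadIndex`,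
`Le`, `headProd`, `cube`, `Params.S`, `leParams`, `mzvTerm`); tail sums `Σ_{t ≥ j} k_t` are spelled
`∑ t ∈ univ.filter (fun t : Fin l => j ≤ (t : ℕ)), k t` (no auxiliary definition). HONEST FRAMING (cell
pub-zeta5): an identity of special functions; nothing here concerns the arithmetic nature of any constant.
References: [Zlobin2012SpecialValues] S. A. Zlobin, *Special values of generalized polylogarithms*, J. Math.
Sci. (N.Y.) 182 (2012) 484–504, arXiv:0712.1656, §2 Theorem 1 (held text `paper:arxiv-0712.1656` p. 3,
re-read on the page); [Zlobin2005Coefficients] (definition of `Le`, §1).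
-/

noncomputable section

open MeasureTheory Set Finset

namespace Literature.NumberTheory.Irrationality.Zlobin2005

open Literature.NumberTheory.Transcendental (mzvTerm)

/-! ### Tail sums `Σ_{t ≥ j} k_t` and the chains `n_j = 1 + Σ_{t ≥ j} k_t` -/

/-- Splitting off the first term of a tail sum: `Σ_{t ≥ j} k_t = k_j + Σ_{t ≥ j+1} k_t` (`j < l`). [folklore] -/
private theorem tailSum_succ {l : ℕ} (k : Fin l → ℕ) (j : Fin l) :
    ∑ t ∈ univ.filter (fun t : Fin l => (j : ℕ) ≤ (t : ℕ)), k t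
      = k j + ∑ t ∈ univ.filter (fun t : Fin l => (j : ℕ) + 1 ≤ (t : ℕ)), k t := by
  have hset : univ.filter (fun t : Fin l => (j : ℕ) ≤ (t : ℕ))
      = insert j (univ.filter (fun t : Fin l => (j : ℕ) + 1 ≤ (t : ℕ))) := by
    ext t
    simp only [Finset.mem_filter, Finset.mem_univ, true_and, Finset.mem_insert]
    constructor
    · intro h
      by_cases hjt : t = j
      · exact Or.inl hjt
      · right
        have : (t : ℕ) ≠ (j : ℕ) := fun h' => hjt (Fin.ext h')
        omega
    · rintro (rfl | h)
      · exact le_rfl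
      · omega
  have hnot : j ∉ univ.filter (fun t : Fin l => (j : ℕ) + 1 ≤ (t : ℕ)) := by simp
  rw [hset, Finset.sum_insert hnot]

/-- A tail sum over an empty range vanishes: `Σ_{t ≥ j} k_t = 0` for `j ≥ l`. [folklore] -/
private theorem tailSum_eq_zero {l : ℕ} (k : Fin l → ℕ) {j : ℕ} (hj : l ≤ j) :
    ∑ t ∈ univ.filter (fun t : Fin l => j ≤ (t : ℕ)), k t = 0 := by
  have : univ.filter (fun t : Fin l => j ≤ (t : ℕ)) = ∅ := by
    ext t
    simp only [Finset.mem_filter, Finset.mem_univ, true_and, Finset.notMem_empty, iff_false, not_le]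
    exact lt_of_lt_of_le t.2 hj
  rw [this, Finset.sum_empty]

/-- The chain `n_j = 1 + Σ_{t ≥ j} k_t` of a vector `k ∈ ℕ^l` is non-increasing with positive entries,
i.e. lies in the summation domain `leIndexSet l` of `Le`. [folklore] -/
private theorem chain_mem_leIndexSet {l : ℕ} (k : Fin l → ℕ) :
    (fun j : Fin l => ∑ t ∈ univ.filter (fun t : Fin l => (j : ℕ) ≤ (t : ℕ)), k t + 1) ∈ leIndexSet l := by
  refine ⟨?_, fun i => Nat.succ_pos _⟩
  intro i j hij
  apply Nat.add_le_add_right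
  apply Finset.sum_le_sum_of_subset
  intro t
  simp only [Finset.mem_filter, Finset.mem_univ, true_and]
  intro h
  exact le_trans (Fin.le_iff_val_le_val.mp hij) h

/-- Successive differences of the chain of `k` give back `k`:
`n_j − n_{j+1} = k_j` (`j < l−1`) and `n_l − 1 = k_l` — the left inverse of `k ↦ n`. [folklore] -/
private theorem diff_chain {l : ℕ} (k : Fin l → ℕ) (j : Fin l) :
    (∑ t ∈ univ.filter (fun t : Fin l => (j : ℕ) ≤ (t : ℕ)), k t + 1)
      - (if h : (j : ℕ) + 1 < l then
          (∑ t ∈ univ.filter (fun t : Fin l => ((⟨(j : ℕ) + 1, h⟩ : Fin l) : ℕ) ≤ (t : ℕ)), k t + 1)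
        else 1)
      = k j := by
  rw [tailSum_succ k j]
  split_ifs with h
  · dsimp only
    omega
  · rw [tailSum_eq_zero k (show l ≤ (j : ℕ) + 1 by omega)]
    omega

/-- The chain of the successive differences of a chain `n₁ ≥ ⋯ ≥ n_l ≥ 1` is `n` itself — the right
inverse of `k ↦ n`. [folklore] -/
private theorem chain_diff {l : ℕ} {n : Fin l → ℕ} (hn : n ∈ leIndexSet l) (j : Fin l) :
    ∑ t ∈ univ.filter (fun t : Fin l => (j : ℕ) ≤ (t : ℕ)),
        (n t - (if h : (t : ℕ) + 1 < l then n ⟨(t : ℕ) + 1, h⟩ else 1)) + 1 = n j := by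
  obtain ⟨hanti, hpos⟩ := hn
  obtain ⟨l', rfl⟩ : ∃ l', l = l' + 1 := ⟨l - 1, by have := j.2; omega⟩
  induction j using Fin.reverseInduction with
  | last =>
      rw [tailSum_succ, tailSum_eq_zero _ (by simp), dif_neg (by simp)]
      have h1 := hpos (Fin.last l')
      simp only [add_zero]
      omega
  | cast i ih =>
      rw [tailSum_succ]
      rw [show ((Fin.succ i : Fin (l' + 1)) : ℕ) = (i : ℕ) + 1 from rfl] at ih
      rw [show ((Fin.castSucc i : Fin (l' + 1)) : ℕ) = (i : ℕ) from rfl,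
        dif_pos (by simp [i.2] : (i : ℕ) + 1 < l' + 1)]
      have heq : (⟨(i : ℕ) + 1, by simp [i.2]⟩ : Fin (l' + 1)) = Fin.succ i := Fin.ext rfl
      rw [heq]
      have hle : n (Fin.succ i) ≤ n (Fin.castSucc i) := hanti (Fin.castSucc_lt_succ (i := i)).le
      have h1 := hpos (Fin.succ i)
      omega

/-- **The reindexing bijection** `ℕ^l ≃ {n₁ ≥ n₂ ≥ ⋯ ≥ n_l ≥ 1}`, `k ↦ n`, `n_j = 1 + Σ_{t ≥ j} k_t`
(inverse: successive differences). [folklore] -/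
private theorem exists_equiv_leIndexSet (l : ℕ) :
    ∃ e : (Fin l → ℕ) ≃ leIndexSet l, ∀ k : Fin l → ℕ,
      ((e k : leIndexSet l) : Fin l → ℕ)
        = fun j : Fin l => ∑ t ∈ univ.filter (fun t : Fin l => (j : ℕ) ≤ (t : ℕ)), k t + 1 :=
  ⟨{ toFun := fun k => ⟨_, chain_mem_leIndexSet k⟩
     invFun := fun n j => n.1 j - (if h : (j : ℕ) + 1 < l then n.1 ⟨(j : ℕ) + 1, h⟩ else 1)
     left_inv := fun k => funext fun j => diff_chain k j
     right_inv := fun n => Subtype.ext (funext fun j => chain_diff n.2 j) },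
    fun _ => rfl⟩

/-! ### The block structure `r_j = s₁ + ⋯ + s_j` of the variables -/

/-- The block ends `r_j = s₁ + ⋯ + s_j` (`(s.take j).sum`) are monotone in `j`. [folklore] -/
private theorem take_sum_le_take_sum (s : List ℕ) {a b : ℕ} (hab : a ≤ b) :
    (s.take a).sum ≤ (s.take b).sum := by
  have hmono : Monotone fun j => (s.take j).sum := by
    refine monotone_nat_of_le_succ fun j => ?_
    by_cases hj : j < s.length
    · simp only [List.sum_take_succ _ _ hj]
      exact Nat.le_add_right _ _
    · rw [List.take_of_length_le (by omega), List.take_of_length_le (by omega)]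
  exact hmono hab

/-- For a variable index `i` of the `j`-th block, `r_{j} ≤ i < r_{j+1}` (0-based `j`), the denominator
factors `1 − z x₁⋯x_{r_t}` containing `x_i` are exactly those with `t ≥ j`:
`{t : i < r_{t+1}} = {t : j ≤ t}`. [folklore] -/
private theorem filter_lt_take_sum_eq {s : List ℕ} (j : Fin s.length) {i : ℕ}
    (h₁ : (s.take (j : ℕ)).sum ≤ i) (h₂ : i < (s.take ((j : ℕ) + 1)).sum) :
    univ.filter (fun t : Fin s.length => i < (s.take ((t : ℕ) + 1)).sum)
      = univ.filter (fun t : Fin s.length => (j : ℕ) ≤ (t : ℕ)) := by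
  ext t
  simp only [Finset.mem_filter, Finset.mem_univ, true_and]
  constructor
  · intro h
    rcases lt_or_ge (t : ℕ) (j : ℕ) with hlt | hge
    · have := take_sum_le_take_sum s (show (t : ℕ) + 1 ≤ (j : ℕ) by omega)
      omega
    · exact hge
  · intro h
    have := take_sum_le_take_sum s (show (j : ℕ) + 1 ≤ (t : ℕ) + 1 by omega)
    omega

/-- Decomposition of `∏_{i < r_J}` into the blocks `r_j ≤ i < r_{j+1}`, `j < J`. [folklore] -/
private theorem prod_range_take_sum (s : List ℕ) (F : ℕ → ℝ) : ∀ J : ℕ,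
    ∏ i ∈ range ((s.take J).sum), F i
      = ∏ j ∈ range J, ∏ i ∈ Ico ((s.take j).sum) ((s.take (j + 1)).sum), F i
  | 0 => by simp
  | J + 1 => by
      rw [Finset.prod_range_succ, ← prod_range_take_sum s F J, Finset.range_eq_Ico, Finset.range_eq_Ico,
        Finset.prod_Ico_consecutive F (Nat.zero_le _) (take_sum_le_take_sum s (Nat.le_succ J))]

/-- **Block bookkeeping.** If the exponent of the variable `x_i` is `e_i = Σ_{t : i < r_{t+1}} k_t`, then
on the `j`-th block (`s_j` variables) `e_i = Σ_{t ≥ j} k_t`, whence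
`∏_{i=1}^{m} f(e_i) = ∏_{j=1}^{l} f(Σ_{t ≥ j} k_t)^{s_j}`. [folklore] -/
private theorem prod_blocks (s : List ℕ) (k : Fin s.length → ℕ) (f : ℕ → ℝ) :
    ∏ i : Fin s.sum, f (∑ t ∈ univ.filter (fun t : Fin s.length => (i : ℕ) < (s.take ((t : ℕ) + 1)).sum), k t)
      = ∏ j : Fin s.length,
          f (∑ t ∈ univ.filter (fun t : Fin s.length => (j : ℕ) ≤ (t : ℕ)), k t) ^ s[j] := by
  rw [Fin.prod_univ_eq_prod_range
    (fun i => f (∑ t ∈ univ.filter (fun t : Fin s.length => i < (s.take ((t : ℕ) + 1)).sum), k t)) s.sum]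
  have h := prod_range_take_sum s
    (fun i => f (∑ t ∈ univ.filter (fun t : Fin s.length => i < (s.take ((t : ℕ) + 1)).sum), k t)) s.length
  rw [List.take_length] at h
  rw [h, ← Fin.prod_univ_eq_prod_range
    (fun j => ∏ i ∈ Ico ((s.take j).sum) ((s.take (j + 1)).sum),
      f (∑ t ∈ univ.filter (fun t : Fin s.length => i < (s.take ((t : ℕ) + 1)).sum), k t)) s.length]
  refine Finset.prod_congr rfl fun j _ => ?_
  rw [Finset.prod_congr rfl (g := fun _ => f (∑ t ∈ univ.filter (fun t : Fin s.length => (j : ℕ) ≤ (t : ℕ)), k t))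
    (fun i hi => by
      rw [Finset.mem_Ico] at hi
      rw [filter_lt_take_sum_eq j hi.1 hi.2])]
  rw [Finset.prod_const, Nat.card_Ico, List.sum_take_succ _ _ j.2, Nat.add_sub_cancel_left, Fin.getElem_fin]

/-! ### Finite products of geometric series -/

/-- **Finite products of absolutely summable real series** (over `ℕ`, indexed by `Fin d`): the family
`ν ↦ ∏_t f_t(ν_t)` is absolutely summable and its sum is the product of the sums. [folklore] -/
private theorem summable_norm_piProd_and_tsum : ∀ (d : ℕ) (f : Fin d → ℕ → ℝ),
    (∀ t, Summable fun n => ‖f t n‖) →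
      (Summable fun ν : Fin d → ℕ => ‖∏ t, f t (ν t)‖) ∧
        ∑' ν : Fin d → ℕ, ∏ t, f t (ν t) = ∏ t, ∑' n, f t n := by
  intro d
  induction d with
  | zero =>
    intro f _
    refine ⟨?_, ?_⟩
    · exact (hasSum_fintype _).summable
    · simp [tsum_fintype]
  | succ d ih =>
    intro f hf
    obtain ⟨ih1, ih2⟩ := ih (fun t => f t.succ) (fun t => hf t.succ)
    have h0 := hf 0
    let e : (ℕ × (Fin d → ℕ)) ≃ (Fin (d + 1) → ℕ) := Fin.consEquiv (fun _ => ℕ)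
    have hfun : ∀ p : ℕ × (Fin d → ℕ), ∏ t, f t (e p t) = f 0 p.1 * ∏ t : Fin d, f t.succ (p.2 t) := by
      intro p
      rw [Fin.prod_univ_succ]
      rfl
    have hnorm : Summable fun p : ℕ × (Fin d → ℕ) => ‖f 0 p.1 * ∏ t : Fin d, f t.succ (p.2 t)‖ :=
      Summable.mul_norm (f := f 0) (g := fun ν : Fin d → ℕ => ∏ t : Fin d, f t.succ (ν t)) h0 ih1
    refine ⟨?_, ?_⟩
    · have : Summable fun p : ℕ × (Fin d → ℕ) => ‖∏ t, f t (e p t)‖ := hnorm.congr fun p => by rw [hfun]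
      exact (e.summable_iff (f := fun ν : Fin (d + 1) → ℕ => ‖∏ t, f t (ν t)‖)).mp this
    · rw [Fin.prod_univ_succ, ← ih2, tsum_mul_tsum_of_summable_norm (f := f 0)
        (g := fun ν : Fin d → ℕ => ∏ t : Fin d, f t.succ (ν t)) h0 ih1]
      rw [← e.tsum_eq (fun ν : Fin (d + 1) → ℕ => ∏ t, f t (ν t))]
      exact tsum_congr fun p => hfun p

/-- **Product of geometric series**: for `0 ≤ u_t < 1`,
`Σ_{ν ∈ ℕ^l} ∏_t u_t^{ν_t} = ∏_t (1 − u_t)⁻¹`, the family being (absolutely) summable. [folklore] -/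
private theorem summable_and_tsum_prod_pow {l : ℕ} (u : Fin l → ℝ) (h0 : ∀ t, 0 ≤ u t) (h1 : ∀ t, u t < 1) :
    (Summable fun ν : Fin l → ℕ => ∏ t, u t ^ ν t) ∧
      ∑' ν : Fin l → ℕ, ∏ t, u t ^ ν t = ∏ t, (1 - u t)⁻¹ := by
  have hgeo : ∀ t, Summable fun n => ‖u t ^ n‖ := by
    intro t
    simp_rw [norm_pow, Real.norm_of_nonneg (h0 t)]
    exact summable_geometric_of_lt_one (h0 t) (h1 t)
  obtain ⟨hs, ht⟩ := summable_norm_piProd_and_tsum l (fun t n => u t ^ n) hgeo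
  exact ⟨hs.of_norm, ht.trans (Finset.prod_congr rfl fun t _ => tsum_geometric_of_lt_one (h0 t) (h1 t))⟩

/-! ### The cube, the monomials and their integrals -/

/-- On the cube, `0 ≤ x₁x₂⋯x_k ≤ 1`. [folklore] -/
private theorem headProd_mem_Icc {m : ℕ} {x : Fin m → ℝ} (hx : x ∈ cube m) (k : ℕ) :
    0 ≤ headProd x k ∧ headProd x k ≤ 1 := by
  have hx' : ∀ i, 0 ≤ x i ∧ x i ≤ 1 := fun i => (Set.mem_univ_pi.mp hx) i
  unfold headProd
  exact ⟨Finset.prod_nonneg fun i _ => (hx' i).1,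
    Finset.prod_le_one (fun i _ => (hx' i).1) fun i _ => (hx' i).2⟩

/-- **Rearranging a product of powers of head products into a monomial**:
`∏_t (z·x₁⋯x_{R_t})^{ν_t} = z^{Σ_t ν_t} · ∏_i x_i^{e_i}` with `e_i = Σ_{t : i < R_t} ν_t`. [folklore] -/
private theorem prod_pow_headProd_eq {m l : ℕ} (z : ℝ) (x : Fin m → ℝ) (R : Fin l → ℕ) (ν : Fin l → ℕ) :
    ∏ t, (z * headProd x (R t)) ^ ν t
      = z ^ (∑ t, ν t) * ∏ i : Fin m, x i ^ (∑ t ∈ univ.filter (fun t : Fin l => (i : ℕ) < R t), ν t) := by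
  simp only [mul_pow, Finset.prod_mul_distrib, Finset.prod_pow_eq_pow_sum]
  congr 1
  unfold headProd
  simp only [← Finset.prod_pow, Finset.prod_filter]
  rw [Finset.prod_comm]
  refine Finset.prod_congr rfl fun i _ => ?_
  rw [Finset.sum_filter, ← Finset.prod_pow_eq_pow_sum]
  refine Finset.prod_congr rfl fun t _ => ?_
  split_ifs <;> simp

/-- **Integral of a monomial over the cube**: `∫_{[0,1]^m} ∏_i x_i^{e_i} dx = ∏_i (e_i + 1)⁻¹`
(Fubini for product functions and `∫₀¹ t^e dt = 1/(e+1)`). [folklore] -/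
private theorem integral_cube_prod_pow (m : ℕ) (e : Fin m → ℕ) :
    ∫ x in cube m, ∏ i, x i ^ e i = ∏ i, ((e i : ℝ) + 1)⁻¹ := by
  unfold cube
  rw [volume_pi, Measure.restrict_pi_pi,
    integral_fintype_prod_eq_prod (𝕜 := ℝ) (fun i (t : ℝ) => t ^ e i)]
  refine Finset.prod_congr rfl fun i _ => ?_
  rw [integral_Icc_eq_integral_Ioc, ← intervalIntegral.integral_of_le zero_le_one, integral_pow]
  simp

/-- The terms `∏_t (z·x₁⋯x_{R_t})^{ν_t}` are continuous, hence integrable on the cube. [folklore] -/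
private theorem integrableOn_prod_pow_headProd {m l : ℕ} (z : ℝ) (R : Fin l → ℕ) (ν : Fin l → ℕ) :
    IntegrableOn (fun x : Fin m → ℝ => ∏ t, (z * headProd x (R t)) ^ ν t) (cube m) := by
  have hcont : Continuous fun x : Fin m → ℝ => ∏ t, (z * headProd x (R t)) ^ ν t := by
    unfold headProd
    fun_prop
  exact hcont.continuousOn.integrableOn_compact (isCompact_univ_pi fun _ => isCompact_Icc)

/-- On the cube the terms `∏_t (z·x₁⋯x_{R_t})^{ν_t}` are nonnegative (`0 ≤ z`). [folklore] -/
private theorem prod_pow_headProd_nonneg {m l : ℕ} {z : ℝ} (hz : 0 ≤ z) {x : Fin m → ℝ} (hx : x ∈ cube m)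
    (R : Fin l → ℕ) (ν : Fin l → ℕ) : 0 ≤ ∏ t, (z * headProd x (R t)) ^ ν t :=
  Finset.prod_nonneg fun _ _ => pow_nonneg (mul_nonneg hz (headProd_mem_Icc hx _).1) _

/-- **The integral of one term**: `∫_{[0,1]^m} ∏_t (z·x₁⋯x_{R_t})^{ν_t} dx = z^{Σν} ∏_i (e_i+1)⁻¹`,
`e_i = Σ_{t : i < R_t} ν_t`. [folklore] -/
private theorem integral_prod_pow_headProd {m l : ℕ} (z : ℝ) (R : Fin l → ℕ) (ν : Fin l → ℕ) :
    ∫ x in cube m, ∏ t, (z * headProd x (R t)) ^ ν t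
      = z ^ (∑ t, ν t) *
          ∏ i : Fin m, ((↑(∑ t ∈ univ.filter (fun t : Fin l => (i : ℕ) < R t), ν t) : ℝ) + 1)⁻¹ := by
  have hfun : (fun x : Fin m → ℝ => ∏ t, (z * headProd x (R t)) ^ ν t)
      = fun x => z ^ (∑ t, ν t) *
          ∏ i : Fin m, x i ^ (∑ t ∈ univ.filter (fun t : Fin l => (i : ℕ) < R t), ν t) :=
    funext fun x => prod_pow_headProd_eq z x R ν
  rw [hfun, integral_const_mul, integral_cube_prod_pow]

/-- The integral of one term is at most `∏_t z^{ν_t}` (`0 ≤ z`). [folklore] -/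
private theorem integral_prod_pow_headProd_le {m l : ℕ} {z : ℝ} (hz : 0 ≤ z) (R : Fin l → ℕ) (ν : Fin l → ℕ) :
    ∫ x in cube m, ∏ t, (z * headProd x (R t)) ^ ν t ≤ ∏ t, z ^ ν t := by
  rw [integral_prod_pow_headProd, Finset.prod_pow_eq_pow_sum]
  refine mul_le_of_le_one_right (pow_nonneg hz _) ?_
  refine Finset.prod_le_one (fun i _ => inv_nonneg.mpr (by positivity)) fun i _ => ?_
  exact inv_le_one_of_one_le₀ (le_add_of_nonneg_left (by positivity))

/-- The integrand of `S(z)` for the parameters `leParams s` (`a = 1`, `b = 2`, `c = 1`, `r_j = s₁+⋯+s_j`) is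
`∏_{j=1}^{l} (1 − z x₁⋯x_{r_j})⁻¹`, the product reindexed by `t = j − 1 : Fin l`.
[cite: Zlobin2012SpecialValues, §2 Theorem 1 (arXiv:0712.1656 p. 3), first identity (integrand)] -/
theorem leParams_integrand_eq (s : List ℕ) (z : ℝ) (x : Fin s.sum → ℝ) :
    (leParams s).integrand z x
      = ∏ t : Fin s.length, (1 - z * headProd x ((s.take ((t : ℕ) + 1)).sum))⁻¹ := by
  simp only [Params.integrand, leParams, Nat.sub_self, pow_zero, mul_one, Finset.prod_const_one, pow_one,
    one_div, ← Finset.prod_inv_distrib]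
  rw [Fin.prod_univ_eq_prod_range (fun t => (1 - z * headProd x ((s.take (t + 1)).sum))⁻¹) s.length,
    Finset.range_eq_Ico, Finset.prod_Ico_add' (fun j => (1 - z * headProd x ((s.take j).sum))⁻¹),
    zero_add, Finset.Ico_add_one_right_eq_Icc]

/-! ### The main theorem -/

/-- **Zlobin 2012, Theorem 1 (first identity) — PROVED**: for a nonempty index `s⃗` of positive integers
and real `0 < z < 1`, `Le_{s₁,…,s_l}(z) = z ∫_{[0,1]^m} dx₁⋯dx_m / ∏_{j=1}^l (1 − z x₁x₂⋯x_{r_j})`,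
`r_j = s₁+⋯+s_j`, `m = w(s⃗)`; i.e. the named fact `le_eq_integral` holds. Proof as printed: geometric
series in each factor, termwise integration over the cube, and the reindexing `k ↦ n`, `n_j = 1 + Σ_{t≥j} k_t`.
[cite: Zlobin2012SpecialValues, §2 Theorem 1 (arXiv:0712.1656 p. 3), first identity] -/
theorem le_eq_integral_holds : le_eq_integral := by
  intro s hs hpos z hz0 hz1
  have hl : 0 < s.length := List.length_pos_of_ne_nil hs
  have hmeas : MeasurableSet (cube s.sum) := MeasurableSet.univ_pi fun _ => measurableSet_Icc
  set l := s.length with hl_def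
  set m := s.sum with hm_def
  set R : Fin l → ℕ := fun t => (s.take ((t : ℕ) + 1)).sum with hR
  set F : (Fin l → ℕ) → (Fin m → ℝ) → ℝ := fun ν x => ∏ t, (z * headProd x (R t)) ^ ν t with hF
  -- Step 1: the integrand of `S` is `∏_t (1 - z x₁⋯x_{R t})⁻¹`, and on the cube it is the sum of the `F ν`
  have hS : (leParams s).S z = ∫ x in cube m, ∑' ν : Fin l → ℕ, F ν x := by
    unfold Params.S
    change ∫ x in cube m, (leParams s).integrand z x = ∫ x in cube m, ∑' ν : Fin l → ℕ, F ν x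
    refine setIntegral_congr_fun hmeas fun x hx => ?_
    have hu0 : ∀ t : Fin l, 0 ≤ z * headProd x (R t) :=
      fun t => mul_nonneg hz0.le (headProd_mem_Icc hx _).1
    have hu1 : ∀ t : Fin l, z * headProd x (R t) < 1 := fun t =>
      lt_of_le_of_lt (mul_le_of_le_one_right hz0.le (headProd_mem_Icc hx _).2) hz1
    change (leParams s).integrand z x = ∑' ν : Fin l → ℕ, ∏ t, (z * headProd x (R t)) ^ ν t
    rw [(summable_and_tsum_prod_pow (fun t => z * headProd x (R t)) hu0 hu1).2, leParams_integrand_eq]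
  -- Step 2: termwise integration
  have hint : ∀ ν, Integrable (F ν) (volume.restrict (cube m)) :=
    fun ν => integrableOn_prod_pow_headProd z R ν
  have hnorm : ∀ ν, ∫ x in cube m, ‖F ν x‖ = ∫ x in cube m, F ν x := fun ν =>
    setIntegral_congr_fun hmeas fun x hx =>
      Real.norm_of_nonneg (prod_pow_headProd_nonneg hz0.le hx R ν)
  have hgeoz := summable_and_tsum_prod_pow (fun _ : Fin l => z) (fun _ => hz0.le) (fun _ => hz1)
  have hsum : Summable fun ν => ∫ x in cube m, ‖F ν x‖ := by
    simp_rw [hnorm]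
    refine Summable.of_nonneg_of_le (fun ν => ?_) (fun ν => integral_prod_pow_headProd_le hz0.le R ν)
      hgeoz.1
    exact setIntegral_nonneg hmeas fun x hx => prod_pow_headProd_nonneg hz0.le hx R ν
  have hswap : ∑' ν, ∫ x in cube m, F ν x = ∫ x in cube m, ∑' ν, F ν x :=
    integral_tsum_of_summable_integral_norm hint hsum
  -- Step 3: reindex the series of `Le` by `k ↦ n`
  obtain ⟨e, he⟩ := exists_equiv_leIndexSet l
  have hterm : ∀ ν : Fin l → ℕ,
      z ^ leadIndex ((e ν : leIndexSet l) : Fin l → ℕ) * mzvTerm s ((e ν : leIndexSet l) : Fin l → ℕ)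
        = z * ∫ x in cube m, F ν x := by
    intro ν
    rw [integral_prod_pow_headProd z R ν, he ν]
    -- the leading index is `1 + Σ_t ν_t`
    have hlead : leadIndex (fun j : Fin l => ∑ t ∈ univ.filter (fun t : Fin l => (j : ℕ) ≤ (t : ℕ)), ν t + 1)
        = ∑ t, ν t + 1 := by
      simp only [leadIndex, dif_pos hl, Finset.filter_true_of_mem (fun (t : Fin l) _ => Nat.zero_le (t : ℕ))]
    rw [hlead, pow_succ, mzvTerm]
    -- the block bookkeeping
    rw [prod_blocks s ν (fun e => ((e : ℝ) + 1)⁻¹)]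
    push_cast
    simp only [inv_pow]
    ring
  unfold Le
  rw [← e.tsum_eq]
  simp_rw [hterm]
  rw [tsum_mul_left, hswap, ← hS]

end Literature.NumberTheory.Irrationality.Zlobin2005
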